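import Mathlib.Algebra.Group.Pi.Lemmas
import Mathlib.Algebra.Group.Submonoid.Operations
import Literature.AlgebraicGeometry.Frobenioids.Monoids
import Literature.AlgebraicGeometry.Frobenioids.MonoidRealification
import Literature.AlgebraicGeometry.Frobenioids.PerfFactorial
import HarnessLib

/-!
# Frobenioids I, Def. 2.4 (i)(c)(d): the factorization data of a monoid, relative to its own primes

Mochizuki, *The geometry of Frobenioids I*, Kyushu J. Math. **62** (2008), §2, Definition 2.4 (i),
kurims pp. 47–48 [cite: MochizukiFrdI2008, Def. 2.4(i) p.47].

Conditions (c) and (d) of "perf-factorial" (and the objects `M^pf_𝔭`, `M^rlf_𝔭 = M^pf_𝔭 ⊗ ℝ_{≥0}`,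
`M^pf_factor`, `M^rlf_factor`, `Bound_{𝔭 ∪ {0}}(a)`, the factorization map and `Supp`) only involve the
monoid `M^pf` and its primes.  `PerfFactorial.lean` records them for `Q := M^pf`; to prove the
closing claims of Def. 2.4 (i) ("`M^pf`, `M^rlf` are also perf-factorial", p. 48) one has to compare
this data for `M^pf`, `(M^pf)^pf ≅ M^pf` and `(M^rlf)^pf ≅ M^rlf`, i.e. to know that it is
*invariant under isomorphisms of the underlying monoid*.  This file therefore spells the same data
out for an ARBITRARY commutative monoid `Q` in the role of `M^pf` (namespace `Factorization`:
`PAt Q 𝔮 = Q_𝔮`, `RAt Q 𝔮 = Q_𝔮 ⊗ ℝ_{≥0}`, `pToR`, `bound`, `fmap`, `supp`, and the conjunction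
`Factorization.Cond Q` of (c), (d)), proves that for `Q = M^pf` it is *definitionally* the data of
`PerfFactorial.lean` (`isPerfFactorial_iff`: `M` is perf-factorial iff `M` is divisorial, every `M_𝔭`
is monoprime, and `Cond (M^pf)`), and supplies the two order-theoretic inputs of the transport
argument: divisibility in `N ⊗ ℝ_{≥0}` is antisymmetric, so suprema there are unique and `divSup`
commutes with isomorphisms into such monoids.  The transport itself is `FactorizationTransport.lean`.
No statement of the paper is strengthened; multiplicative notation as in `Monoids.lean`.
-/

noncomputable section

namespace Literature.AlgebraicGeometry.Frobenioids

open Function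

universe u

/-! ### Divisibility in `N ⊗ ℝ_{≥0}` is antisymmetric; `divSup` under isomorphisms -/

section RealificationOrder

variable {N : Type u} [CommMonoid N]

/-- An element of `N ⊗ ℝ_{≥0} = Hom(N^∨, ℝ_{≥0})` viewed as the homomorphism `N^∨ → ℝ_{≥0}` it is
(the identity map, retyped; `Realification` is not reducible). [cite: MochizukiFrdI2008, §0 p.10] -/
def Realification.toHom (s : Realification N) : RDual N →* Multiplicative NNReal := s

/-- `toHom` is injective (it is the identity). [cite: MochizukiFrdI2008, §0 p.10] -/
theorem Realification.toHom_injective : Injective (Realification.toHom (N := N)) := fun _ _ h => h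

/-- Extensionality for `N ⊗ ℝ_{≥0}`. [cite: MochizukiFrdI2008, §0 p.10] -/
theorem Realification.ext' {s s' : Realification N} (h : ∀ f, s.toHom f = s'.toHom f) : s = s' :=
  Realification.toHom_injective (MonoidHom.ext h)

/-- `toHom` is multiplicative. [cite: MochizukiFrdI2008, §0 p.10] -/
@[simp] theorem Realification.toHom_mul (s t : Realification N) : (s * t).toHom = s.toHom * t.toHom := rfl

/-- `toHom 1 = 1`. [cite: MochizukiFrdI2008, §0 p.10] -/
@[simp] theorem Realification.toHom_one : (1 : Realification N).toHom = 1 := rfl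

/-- `toHom (of a) f = f a`. [cite: MochizukiFrdI2008, §0 p.10] -/
@[simp] theorem Realification.toHom_of (a : N) (f : RDual N) : (Realification.of N a).toHom f = f a := rfl

/-- In `N ⊗ ℝ_{≥0} = Hom(N^∨, ℝ_{≥0})` divisibility is the pointwise order: `s ∣ s'` implies
`s(f) ≤ s'(f)` for all `f`. [cite: MochizukiFrdI2008, §0 p.10] -/
theorem Realification.apply_le_of_dvd {s s' : Realification N} (h : s ∣ s') (f : RDual N) :
    Multiplicative.toAdd (s.toHom f) ≤ Multiplicative.toAdd (s'.toHom f) := by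
  obtain ⟨c, rfl⟩ := h
  rw [Realification.toHom_mul, MonoidHom.mul_apply, toAdd_mul]
  exact le_self_add

/-- **Divisibility in `N ⊗ ℝ_{≥0}` is antisymmetric** (so `(N ⊗ ℝ_{≥0}, ≤)` is a partial order and
suprema, when they exist, are unique; §0 p. 12). [cite: MochizukiFrdI2008, §0 p.12] -/
theorem Realification.dvd_antisymm {s s' : Realification N} (h : s ∣ s') (h' : s' ∣ s) : s = s' :=
  Realification.ext' fun f => Multiplicative.toAdd.injective
    (le_antisymm (Realification.apply_le_of_dvd h f) (Realification.apply_le_of_dvd h' f))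

/-- `N ⊗ ℝ_{≥0}` is cancellative (pointwise in `ℝ_{≥0}`). [cite: MochizukiFrdI2008, §0 p.10] -/
theorem Realification.mul_left_cancel' {s t t' : Realification N} (h : s * t = s * t') : t = t' := by
  apply Realification.ext'
  intro f
  have h1 := DFunLike.congr_fun (congrArg Realification.toHom h) f
  rw [Realification.toHom_mul, Realification.toHom_mul, MonoidHom.mul_apply, MonoidHom.mul_apply] at h1
  have h2 := congrArg Multiplicative.toAdd h1
  rw [toAdd_mul, toAdd_mul] at h2
  exact Multiplicative.toAdd.injective (add_left_cancel h2)

variable {R : Type u} [CommMonoid R] {R' : Type u} [CommMonoid R']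

/-- A supremum for the divisibility order transported along an isomorphism is a supremum of the
image. [cite: MochizukiFrdI2008, §0 p.12] -/
theorem isSup_image_of_isSup (ρ : R ≃* R') {S : Set R} {s : R}
    (hs : ∀ b : R, IsBoundedBy S b ↔ s ∣ b) (b' : R') : IsBoundedBy (ρ '' S) b' ↔ ρ s ∣ b' := by
  rw [isBoundedBy_image_iff_symm ρ, hs, ← map_dvd_iff ρ, ρ.apply_symm_apply]
where
  /-- `ρ(S)` bounded by `b'` iff `S` bounded by `ρ⁻¹ b'`. [cite: MochizukiFrdI2008, §0 p.12] -/
  isBoundedBy_image_iff_symm (ρ : R ≃* R') {S : Set R} {b' : R'} :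
      IsBoundedBy (ρ '' S) b' ↔ IsBoundedBy S (ρ.symm b') := by
    constructor
    · intro h a ha
      have := h (ρ a) ⟨a, ha, rfl⟩
      rwa [← ρ.apply_symm_apply b', map_dvd_iff] at this
    · rintro h _ ⟨a, ha, rfl⟩
      have := (map_dvd_iff ρ).mpr (h a ha)
      rwa [ρ.apply_symm_apply] at this

/-- **`divSup` commutes with isomorphisms** into a monoid whose divisibility order is antisymmetric
(e.g. any `N ⊗ ℝ_{≥0}`): `ρ(sup S) = sup ρ(S)`, including the conventional value `0` when no supremum
exists. [cite: MochizukiFrdI2008, §0 p.12] -/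
theorem map_divSup (ρ : R ≃* R') (hanti : ∀ s₁ s₂ : R', s₁ ∣ s₂ → s₂ ∣ s₁ → s₁ = s₂) (S : Set R) :
    ρ (divSup S) = divSup (ρ '' S) := by
  classical
  by_cases h : ∃ s : R, ∀ b : R, IsBoundedBy S b ↔ s ∣ b
  · have hspec : ∀ b, IsBoundedBy S b ↔ divSup S ∣ b := divSup_spec h
    have h' : ∃ s' : R', ∀ b' : R', IsBoundedBy (ρ '' S) b' ↔ s' ∣ b' :=
      ⟨ρ (divSup S), isSup_image_of_isSup ρ hspec⟩
    have hspec' : ∀ b', IsBoundedBy (ρ '' S) b' ↔ divSup (ρ '' S) ∣ b' := divSup_spec h'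
    apply hanti
    · exact (isSup_image_of_isSup ρ hspec _).mp ((hspec' _).mpr dvd_rfl)
    · exact (hspec' _).mp ((isSup_image_of_isSup ρ hspec _).mpr dvd_rfl)
  · have h' : ¬ ∃ s' : R', ∀ b' : R', IsBoundedBy (ρ '' S) b' ↔ s' ∣ b' := by
      rintro ⟨s', hs'⟩
      refine h ⟨ρ.symm s', fun b => ?_⟩
      have := isSup_image_of_isSup ρ.symm hs' b
      rwa [← Set.image_comp, show (ρ.symm : R' → R) ∘ (ρ : R → R') = id from
        funext fun x => ρ.symm_apply_apply x, Set.image_id] at this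
    rw [divSup, divSup, dif_neg h, dif_neg h', map_one]

end RealificationOrder

/-! ### The factorization data of a monoid `Q` relative to `Prime(Q)` -/

namespace Factorization

variable (Q : Type u) [CommMonoid Q]

/-- `Q_𝔮`, the submonoid generated by the prime `𝔮 ∈ Prime(Q)` (§0 p. 12), as a type; for `Q = M^pf`
this is `M^pf_𝔮` of Def. 2.4 (i). [cite: MochizukiFrdI2008, Def. 2.4(i) p.47] -/
abbrev PAt (𝔮 : Primes Q) : Type u := ↥(𝔮.submonoid)

/-- `Q_𝔮 ⊗ ℝ_{≥0}`; for `Q = M^pf` this is `M^rlf_𝔮`. [cite: MochizukiFrdI2008, Def. 2.4(i) p.47] -/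
abbrev RAt (𝔮 : Primes Q) : Type u := Realification (PAt Q 𝔮)

/-- `∏_𝔮 Q_𝔮`; for `Q = M^pf` this is `M^pf_factor`. [cite: MochizukiFrdI2008, Def. 2.4(i) p.47] -/
abbrev PFactor : Type u := ∀ 𝔮 : Primes Q, PAt Q 𝔮

/-- `∏_𝔮 Q_𝔮 ⊗ ℝ_{≥0}`; for `Q = M^pf` this is `M^rlf_factor`. [cite: MochizukiFrdI2008, Def. 2.4(i) p.47] -/
abbrev RFactor : Type u := ∀ 𝔮 : Primes Q, RAt Q 𝔮

/-- The componentwise natural map `∏ Q_𝔮 → ∏ Q_𝔮 ⊗ ℝ_{≥0}` (`pfFactorToRlfFactor` for `Q = M^pf`).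
[cite: MochizukiFrdI2008, Def. 2.4(i) p.47] -/
def pToR : PFactor Q →* RFactor Q where
  toFun x 𝔮 := Realification.of (PAt Q 𝔮) (x 𝔮)
  map_one' := funext fun 𝔮 => map_one (Realification.of (PAt Q 𝔮))
  map_mul' x y := funext fun 𝔮 => map_mul (Realification.of (PAt Q 𝔮)) (x 𝔮) (y 𝔮)

/-- `pToR` componentwise. [cite: MochizukiFrdI2008, Def. 2.4(i) p.47] -/
@[simp] theorem pToR_apply (x : PFactor Q) (𝔮 : Primes Q) :
    pToR Q x 𝔮 = Realification.of (PAt Q 𝔮) (x 𝔮) := rfl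

/-- `Bound_{𝔮 ∪ {0}}(a) ⊆ Q_𝔮 ⊗ ℝ_{≥0}` (`boundAt` for `Q = M^pf`). [cite: MochizukiFrdI2008, Def. 2.4(i) p.47] -/
def bound (𝔮 : Primes Q) (a : Q) : Set (RAt Q 𝔮) :=
  {y | ∃ x : PAt Q 𝔮, (x.1 ∈ 𝔮.carrier ∨ x.1 = 1) ∧ x.1 ∣ a ∧ y = Realification.of (PAt Q 𝔮) x}

/-- The factorization map `Q → ∏ Q_𝔮 ⊗ ℝ_{≥0}`, `a ↦ (sup Bound_{𝔮 ∪ {0}}(a))_𝔮` (`factorMap` for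
`Q = M^pf`). [cite: MochizukiFrdI2008, Def. 2.4(i) p.47] -/
def fmap (a : Q) : RFactor Q := fun 𝔮 => divSup (bound Q 𝔮 a)

variable {Q} in
/-- `Supp(a) ⊆ Prime(Q)` (`supp` for `Q = M^pf`). [cite: MochizukiFrdI2008, Def. 2.4(i) p.47] -/
def supp (a : RFactor Q) : Set (Primes Q) := {𝔮 | a 𝔮 ≠ 1}

/-- **Conditions (c) and (d) of Def. 2.4 (i)** for the monoid `Q` in the role of `M^pf`: the
factorization map is well defined (bounded), a homomorphism, injective, with image in `∏ Q_𝔮`, and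
(d) an element of `∏ Q_𝔮` whose support lies in the support of some `fmap b` is in the image.
[cite: MochizukiFrdI2008, Def. 2.4(i) p.47] -/
structure Cond : Prop where
  /-- (c) well-defined: each `Bound_{𝔮 ∪ {0}}(a)` is bounded -/
  bounded : ∀ (𝔮 : Primes Q) (a : Q), ∃ b, IsBoundedBy (bound Q 𝔮 a) b
  /-- (c) homomorphism: unit -/
  fmap_one : fmap Q 1 = 1
  /-- (c) homomorphism: products -/
  fmap_mul : ∀ a b : Q, fmap Q (a * b) = fmap Q a * fmap Q b
  /-- (c) injective -/
  fmap_injective : Injective (fmap Q)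
  /-- (c) image in `∏ Q_𝔮` -/
  fmap_mem_range : ∀ a : Q, fmap Q a ∈ Set.range (pToR Q)
  /-- (d) -/
  mem_range_of_supp_subset : ∀ (x : PFactor Q) (b : Q),
    supp (pToR Q x) ⊆ supp (fmap Q b) → pToR Q x ∈ Set.range (fmap Q)

variable {Q}

/-- `Supp` of a product is contained in the union of the `Supp`s. [cite: MochizukiFrdI2008, Def. 2.4(i) p.48] -/
theorem supp_mul_subset (a b : RFactor Q) : supp (a * b) ⊆ supp a ∪ supp b := by
  intro 𝔮 h
  by_contra h'
  simp only [Set.mem_union, supp, Set.mem_setOf_eq, not_or, not_not] at h'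
  exact h (by rw [Pi.mul_apply, h'.1, h'.2, mul_one])

/-- `Supp(a) ⊆ Supp(a · b)` (each factor is sharp). [cite: MochizukiFrdI2008, Def. 2.4(i) p.48] -/
theorem supp_subset_supp_mul (a b : RFactor Q) : supp a ⊆ supp (a * b) := by
  intro 𝔮 h h'
  rw [Pi.mul_apply] at h'
  exact h ((isSharp_realification _).1 _ (IsUnit.of_mul_eq_one _ h'))

/-- The element `a ∈ Bound_{𝔮 ∪ {0}}(a)`-test: if `x ∈ Q_𝔮` is primary-or-trivial and divides `a` then
`x ⊗ 1 ≤ fmap(a)_𝔮` whenever the supremum exists. [cite: MochizukiFrdI2008, Def. 2.4(i) p.47] -/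
theorem of_dvd_fmap {𝔮 : Primes Q} {a : Q} (h : ∃ s, ∀ b, IsBoundedBy (bound Q 𝔮 a) b ↔ s ∣ b)
    (x : PAt Q 𝔮) (hx : x.1 ∈ 𝔮.carrier ∨ x.1 = 1) (hxa : x.1 ∣ a) :
    Realification.of (PAt Q 𝔮) x ∣ fmap Q a 𝔮 :=
  ((divSup_spec h (fmap Q a 𝔮)).mpr dvd_rfl) _ ⟨x, hx, hxa, rfl⟩

end Factorization

/-! ### `Q = M^pf`: the data of `PerfFactorial.lean`, definitionally -/

section Bridge

variable {M : Type u} [CommMonoid M]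

/-- `M^pf_factor → M^rlf_factor` is `Factorization.pToR (M^pf)`. [cite: MochizukiFrdI2008, Def. 2.4(i) p.47] -/
theorem pfFactorToRlfFactor_eq : pfFactorToRlfFactor M = Factorization.pToR (Perfection M) := rfl

/-- `Bound_{𝔮 ∪ {0}}(a)` of `PerfFactorial.lean` is `Factorization.bound (M^pf)`. [cite: MochizukiFrdI2008, Def. 2.4(i) p.47] -/
theorem boundAt_eq : boundAt M = Factorization.bound (Perfection M) := rfl

/-- The factorization map of `PerfFactorial.lean` is `Factorization.fmap (M^pf)`. [cite: MochizukiFrdI2008, Def. 2.4(i) p.47] -/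
theorem factorMap_eq : factorMap M = Factorization.fmap (Perfection M) := rfl

/-- `Supp` of `PerfFactorial.lean` is `Factorization.supp`. [cite: MochizukiFrdI2008, Def. 2.4(i) p.47] -/
theorem supp_eq (a : RlfFactor M) : supp a = Factorization.supp a := rfl

/-- **`M` is perf-factorial iff `M` is divisorial, every `M_𝔭` is monoprime, and conditions (c), (d)
hold for `M^pf`** — Def. 2.4 (i) regrouped. [cite: MochizukiFrdI2008, Def. 2.4(i) p.47] -/
theorem isPerfFactorial_iff :
    IsPerfFactorial M ↔ IsDivisorial M ∧ (∀ 𝔭 : Primes M, IsMonoprime ↥𝔭.submonoid) ∧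
      Factorization.Cond (Perfection M) := by
  constructor
  · intro h
    exact ⟨h.isDivisorial, h.isMonoprime,
      { bounded := h.bounded
        fmap_one := h.factorMap_one
        fmap_mul := h.factorMap_mul
        fmap_injective := h.factorMap_injective
        fmap_mem_range := h.factorMap_mem_range
        mem_range_of_supp_subset := h.mem_range_of_supp_subset }⟩
  · rintro ⟨h₁, h₂, h₃⟩
    exact
      { isDivisorial := h₁
        isMonoprime := h₂
        bounded := h₃.bounded
        factorMap_one := h₃.fmap_one
        factorMap_mul := h₃.fmap_mul
        factorMap_injective := h₃.fmap_injective
        factorMap_mem_range := h₃.fmap_mem_range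
        mem_range_of_supp_subset := h₃.mem_range_of_supp_subset }

/-- Assembling `IsPerfFactorial` from the three parts. [cite: MochizukiFrdI2008, Def. 2.4(i) p.47] -/
theorem IsPerfFactorial.of_cond (h₁ : IsDivisorial M) (h₂ : ∀ 𝔭 : Primes M, IsMonoprime ↥𝔭.submonoid)
    (h₃ : Factorization.Cond (Perfection M)) : IsPerfFactorial M :=
  isPerfFactorial_iff.mpr ⟨h₁, h₂, h₃⟩

/-- The (c)(d) part of a perf-factorial monoid. [cite: MochizukiFrdI2008, Def. 2.4(i) p.47] -/
theorem IsPerfFactorial.cond (h : IsPerfFactorial M) : Factorization.Cond (Perfection M) :=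
  (isPerfFactorial_iff.mp h).2.2

end Bridge

end Literature.AlgebraicGeometry.Frobenioids
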